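import Literature.NumberTheory.DiophantineApproximation.RhinViolaLemma26Integrals
import Literature.NumberTheory.DiophantineApproximation.RhinViolaLemma27
import HarnessLib

/-!
# Rhin–Viola 2005, Lemma 2.6: Theorem 2.1 for the tuples `(0, 0, k, l, 0)`, `k, l ≥ 1`

Topic `Literature/NumberTheory/DiophantineApproximation`. DEFINITIONS (the integer polynomials `gZ`, `revNeg`,
`cHat`, `lemma26P`, `lemma26R`) and proved theorems; no named facts. Source: G. Rhin, C. Viola, *The permutation
group method for the dilogarithm*, Ann. Sc. Norm. Super. Pisa Cl. Sci. (5) 4 (2005) 389–437, Lemma 2.6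
(pp. 399–402): if `h = j = m = 0` then Theorem 2.1 holds, with `Q = 0` unless `k = l = 0`. Here `H = K = max{k,l}`,
`α = β = δ = k + l`, and the content is

  `d_{max{k,l}}² z^{k+l}(z−1)^{k+l} I_z(0,0,k,l,0) = P(z)`,  `d_{max{k,l}}² z^{k+l}(z−1)^{k+l} I_z^{(1)}(0,0,k,l,0) = R(z)`,
  `I_z^{(2)}(0,0,k,l,0) = 0`,  `P, R ∈ ℤ[z]`, `deg P, deg R ≤ k + l`

(the paper's sharper statements are `k z^{min{k,l}}(z−1)^{k+l} I^{(1)} ∈ ℤ[z]` (2.22) and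
`d_{max{k−1,l}} k z^{k+l}(z−1)^{k+l} I_z ∈ ℤ[z]`). We obtain them from the closed forms of
`RhinViolaLemma26Integrals.lean`: with `g = Y^k(1−Y)^{l−1}`, `y₁ = 1/(1−z)` and `c_i = (D^{(i)}g)(y₁)`,
`I^{(1)} = −z^{−l} c_{k−1}/(k(z−1)^k)` and
`I_z = (z^{−l}/k)(z^{−k}/l − Σ_{i≠k−1} c_i (z^{i−k+1}−1)(z−1)^{−(i+1)}/(i−k+1))`; the polynomials
`Ĉ_i(z) = (z−1)^{k+l−1−i} c_i ∈ ℤ[z]` (`cHat`, of degree `≤ min{l−1, k+l−1−i}`) make every term an integer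
polynomial: `z^k(z−1)^l·c_i(z^{e}−1)(z−1)^{−(i+1)} = Ĉ_i(z)(z^{i+1} − z^k)`, `e = i−k+1`, with the denominators
`k·e ∣ d_{max{k,l}}²` (`|e| ≤ max{k−1,l}`) and `k·l ∣ d_{max{k,l}}²`. The case `l = 0` (Lemma 2.4) and the
`λ`-symmetric family `(0,0,0,l,0)` (Lemma 2.5) are treated separately.

## References

* G. Rhin, C. Viola, Ann. Sc. Norm. Super. Pisa Cl. Sci. (5) 4 (2005) 389–437, Lemma 2.6, (2.20)–(2.24).
  [RhinViola2005]
-/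

noncomputable section

namespace Literature.NumberTheory.DiophantineApproximation

namespace RhinViola

open Finset Polynomial
open DilogPade (polylogSeries)

/-! ### Integer-coefficient bookkeeping for the Hasse derivatives at `y₁ = 1/(1−z)` -/

/-- `g = Y^k (1−Y)^{l−1}` as an integer polynomial. [cite: RhinViola2005, Lemma 2.6 (proof)] -/
def gZ (k l : ℕ) : ℤ[X] := X ^ k * (1 - X) ^ (l - 1)

/-- Hasse derivatives commute with `Polynomial.map`. [folklore] -/
theorem hasseDeriv_map (f : ℤ →+* ℝ) (i : ℕ) (p : ℤ[X]) : hasseDeriv i (p.map f) = (hasseDeriv i p).map f := by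
  ext n
  simp [hasseDeriv_coeff, coeff_map]

/-- The real polynomial `Y^k(1−Y)^{l−1}` is the image of `gZ`. [folklore] -/
theorem map_gZ (k l : ℕ) : (gZ k l).map (Int.castRingHom ℝ) = (X : ℝ[X]) ^ k * (1 - X) ^ (l - 1) := by
  simp [gZ, Polynomial.map_mul, Polynomial.map_pow, Polynomial.map_sub]

/-- `c_i = (D^{(i)}(Y^k(1−Y)^{l−1}))(y) = aeval y (D^{(i)} gZ)`. [folklore] -/
theorem hasseDeriv_eval_eq_aeval_gZ (k l i : ℕ) (y : ℝ) :
    (hasseDeriv i ((X : ℝ[X]) ^ k * (1 - X) ^ (l - 1))).eval y = aeval y (hasseDeriv i (gZ k l)) := by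
  rw [← map_gZ, hasseDeriv_map, eval_map, aeval_def, algebraMap_int_eq]

/-- `deg gZ ≤ k + l − 1` (for `l ≥ 1`). [folklore] -/
theorem natDegree_gZ_le {k l : ℕ} (hl : 1 ≤ l) : (gZ k l).natDegree ≤ k + l - 1 := by
  have := natDegree_X_pow_mul_one_sub_X_pow_le k (l - 1)
  rw [gZ]; omega

/-- The low coefficients of `D^{(i)} gZ` vanish: `(D^{(i)} gZ).coeff t = 0` for `t + i < k`. [folklore] -/
theorem coeff_hasseDeriv_gZ_eq_zero {k l i t : ℕ} (h : t + i < k) : (hasseDeriv i (gZ k l)).coeff t = 0 := by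
  rw [hasseDeriv_coeff, gZ, coeff_X_pow_mul', if_neg (by omega), mul_zero]

/-- **Reverse-and-shift**: `revNeg D F = Σ_{t≤D} F_t (−1)^t (X−1)^{D−t}`, the integer polynomial with
`revNeg D F (z) = (z−1)^D · F(1/(1−z))` when `deg F ≤ D`. [folklore] -/
def revNeg (D : ℕ) (F : ℤ[X]) : ℤ[X] :=
  ∑ t ∈ range (D + 1), C (F.coeff t * (-1) ^ t) * (X - 1) ^ (D - t)

/-- `revNeg D F (z) = (z−1)^D · F(1/(1−z))` for `deg F ≤ D`, `z ≠ 1`. [folklore] -/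
theorem aeval_revNeg {D : ℕ} {F : ℤ[X]} (hF : F.natDegree ≤ D) {z : ℝ} (hz : z ≠ 1) :
    aeval z (revNeg D F) = (z - 1) ^ D * aeval (1 / (1 - z)) F := by
  have hz1 : 1 - z ≠ 0 := sub_ne_zero.2 (Ne.symm hz)
  have hz1' : z - 1 ≠ 0 := sub_ne_zero.2 hz
  rw [aeval_eq_sum_range' (Nat.lt_succ_of_le hF), revNeg, map_sum, mul_sum]
  refine sum_congr rfl fun t ht => ?_
  have htD : t ≤ D := Nat.lt_succ_iff.1 (mem_range.1 ht)
  rw [map_mul, aeval_C, map_pow, map_sub, aeval_X, map_one, zsmul_eq_mul]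
  simp only [algebraMap_int_eq, eq_intCast, Int.cast_mul, Int.cast_pow, Int.cast_neg, Int.cast_one]
  rw [show (z - 1) ^ D = (z - 1) ^ (D - t) * (z - 1) ^ t by rw [← pow_add, Nat.sub_add_cancel htD],
    show (1 : ℝ) / (1 - z) = -1 / (z - 1) by field_simp; ring, div_pow]
  field_simp

/-- `deg (revNeg D F) ≤ D − t₀` if the coefficients `F_t`, `t < t₀`, vanish. [folklore] -/
theorem natDegree_revNeg_le {D t₀ : ℕ} {F : ℤ[X]} (h0 : ∀ t < t₀, F.coeff t = 0) :
    (revNeg D F).natDegree ≤ D - t₀ := by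
  refine natDegree_sum_le_of_forall_le _ _ fun t _ => ?_
  by_cases ht : t < t₀
  · rw [h0 t ht, zero_mul, C_0, zero_mul, natDegree_zero]
    exact Nat.zero_le _
  · refine (natDegree_C_mul_le _ _).trans ?_
    have := natDegree_pow_le_of_le (D - t)
      (show (X - 1 : ℤ[X]).natDegree ≤ 1 from (natDegree_sub_le _ _).trans (by simp))
    rw [mul_one] at this
    exact this.trans (by omega)

/-- `Ĉ_i = revNeg (k+l−1−i) (D^{(i)} gZ)`, so that `Ĉ_i(z) = (z−1)^{k+l−1−i} c_i`. [cite: RhinViola2005, Lemma 2.6 (proof)] -/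
def cHat (k l i : ℕ) : ℤ[X] := revNeg (k + l - 1 - i) (hasseDeriv i (gZ k l))

/-- `Ĉ_i(z) = (z−1)^{k+l−1−i} · (D^{(i)}(Y^k(1−Y)^{l−1}))(1/(1−z))` for `z ≠ 1`, `l ≥ 1`. [cite: RhinViola2005, (2.22)] -/
theorem aeval_cHat {k l : ℕ} (hl : 1 ≤ l) (i : ℕ) {z : ℝ} (hz : z ≠ 1) :
    aeval z (cHat k l i) =
      (z - 1) ^ (k + l - 1 - i) * (hasseDeriv i ((X : ℝ[X]) ^ k * (1 - X) ^ (l - 1))).eval (1 / (1 - z)) := by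
  rw [cHat, aeval_revNeg ?_ hz, hasseDeriv_eval_eq_aeval_gZ]
  exact (natDegree_hasseDeriv_le _ _).trans (by have := natDegree_gZ_le (k := k) hl; omega)

/-- `deg Ĉ_i ≤ k + l − 1 − i`. [folklore] -/
theorem natDegree_cHat_le (k l i : ℕ) : (cHat k l i).natDegree ≤ k + l - 1 - i := by
  have := natDegree_revNeg_le (D := k + l - 1 - i) (t₀ := 0) (F := hasseDeriv i (gZ k l)) (fun t ht => by omega)
  simpa [cHat] using this

/-- `deg Ĉ_i ≤ l − 1` (the coefficients of `D^{(i)}gZ` below degree `k − i` vanish). [folklore] -/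
theorem natDegree_cHat_le' (k l i : ℕ) : (cHat k l i).natDegree ≤ l - 1 := by
  have := natDegree_revNeg_le (D := k + l - 1 - i) (t₀ := k - i) (F := hasseDeriv i (gZ k l))
    (fun t ht => coeff_hasseDeriv_gZ_eq_zero (by omega))
  rw [cHat]
  exact this.trans (by omega)

/-! ### The polynomials `P`, `R` of Lemma 2.6 -/

/-- `R = −(d²/k) X^k Ĉ_{k−1}`, `d = d_{max{k,l}}`. [cite: RhinViola2005, (2.22)] -/
def lemma26R (k l : ℕ) : ℤ[X] :=
  -(C (((Nat.lcmUpto (max k l) * Nat.lcmUpto (max k l) : ℕ) : ℤ) / k) * X ^ k * cHat k l (k - 1))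

/-- `P = (d²/(kl)) (X−1)^{k+l} − Σ_{i<k+l, i≠k−1} (d²/(k(i−k+1))) Ĉ_i (X^{i+1} − X^k)`, `d = d_{max{k,l}}`.
[cite: RhinViola2005, Lemma 2.6 (proof), (2.21)] -/
def lemma26P (k l : ℕ) : ℤ[X] :=
  C (((Nat.lcmUpto (max k l) * Nat.lcmUpto (max k l) : ℕ) : ℤ) / (k * l : ℕ)) * (X - 1) ^ (k + l) -
    ∑ i ∈ (range (k + l)).erase (k - 1),
      C (((Nat.lcmUpto (max k l) * Nat.lcmUpto (max k l) : ℕ) : ℤ) / ((k : ℤ) * ((i : ℤ) - k + 1))) *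
        (cHat k l i * (X ^ (i + 1) - X ^ k))

/-- `deg R ≤ k + l`. [cite: RhinViola2005, Lemma 2.6] -/
theorem natDegree_lemma26R_le {k l : ℕ} (hl : 1 ≤ l) : (lemma26R k l).natDegree ≤ k + l := by
  rw [lemma26R, natDegree_neg]
  refine (natDegree_mul_le).trans ?_
  have h1 : (C (((Nat.lcmUpto (max k l) * Nat.lcmUpto (max k l) : ℕ) : ℤ) / k) * (X : ℤ[X]) ^ k).natDegree ≤ k :=
    (natDegree_C_mul_le _ _).trans (natDegree_X_pow k).le
  have h2 := natDegree_cHat_le' k l (k - 1)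
  omega

/-- `deg P ≤ k + l`. [cite: RhinViola2005, Lemma 2.6] -/
theorem natDegree_lemma26P_le (k l : ℕ) : (lemma26P k l).natDegree ≤ k + l := by
  rw [lemma26P]
  refine (natDegree_sub_le _ _).trans (max_le ?_ ?_)
  · refine (natDegree_C_mul_le _ _).trans ?_
    have := natDegree_pow_le_of_le (k + l)
      (show (X - 1 : ℤ[X]).natDegree ≤ 1 from (natDegree_sub_le _ _).trans (by simp))
    simpa using this
  · refine natDegree_sum_le_of_forall_le _ _ fun i hi => ?_
    have hi' := mem_range.1 (mem_erase.1 hi).2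
    refine (natDegree_C_mul_le _ _).trans (natDegree_mul_le.trans ?_)
    have e1 := natDegree_cHat_le k l i
    have e1' := natDegree_cHat_le' k l i
    have e2 : ((X : ℤ[X]) ^ (i + 1) - X ^ k).natDegree ≤ max (i + 1) k :=
      (natDegree_sub_le _ _).trans (max_le_max (natDegree_X_pow _).le (natDegree_X_pow _).le)
    rcases le_or_gt k (i + 1) with hk | hk
    · rw [max_eq_left hk] at e2; omega
    · rw [max_eq_right hk.le] at e2; omega

/-! ### Divisibility of the denominators -/

/-- `k ∣ d_{max{k,l}}` for `k ≥ 1`. [folklore] -/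
theorem dvd_lcmUpto_max_left {k l : ℕ} (hk : 1 ≤ k) : (k : ℤ) ∣ (Nat.lcmUpto (max k l) : ℤ) :=
  DilogPade.natCast_dvd_lcmUpto hk (le_max_left _ _)

/-- `i − k + 1 ∣ d_{max{k,l}}` for `i < k + l`, `i ≠ k − 1` (`|i−k+1| ≤ max{k−1,l}`). [cite: RhinViola2005, Lemma 2.6 (proof)] -/
theorem sub_dvd_lcmUpto_max {k l i : ℕ} (hk : 1 ≤ k) (hi : i < k + l) (hi' : i ≠ k - 1) :
    ((i : ℤ) - k + 1) ∣ (Nat.lcmUpto (max k l) : ℤ) := by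
  rcases lt_or_gt_of_ne hi' with h | h
  · -- negative: `i − k + 1 = −(k − 1 − i)`
    have hd : (((k - 1 - i : ℕ) : ℤ)) ∣ (Nat.lcmUpto (max k l) : ℤ) :=
      DilogPade.natCast_dvd_lcmUpto (by omega) (by omega)
    have he : ((i : ℤ) - k + 1) = -((k - 1 - i : ℕ) : ℤ) := by omega
    rw [he]
    exact (neg_dvd).2 hd
  · have hd : (((i + 1 - k : ℕ) : ℤ)) ∣ (Nat.lcmUpto (max k l) : ℤ) :=
      DilogPade.natCast_dvd_lcmUpto (by omega) (by omega)
    have he : ((i : ℤ) - k + 1) = ((i + 1 - k : ℕ) : ℤ) := by omega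
    rwa [he]

/-! ### The evaluations -/

/-- `R(z) = −(d²/k) z^k (z−1)^l c_{k−1}`. [cite: RhinViola2005, (2.22)] -/
theorem aeval_lemma26R {k l : ℕ} (hk : 1 ≤ k) (hl : 1 ≤ l) {z : ℝ} (hz : z ≠ 1) :
    aeval z (lemma26R k l) = -((Nat.lcmUpto (max k l) : ℝ) * Nat.lcmUpto (max k l) / k * z ^ k *
      ((z - 1) ^ l * (hasseDeriv (k - 1) ((X : ℝ[X]) ^ k * (1 - X) ^ (l - 1))).eval (1 / (1 - z)))) := by
  have hdvd : (k : ℤ) ∣ ((Nat.lcmUpto (max k l) * Nat.lcmUpto (max k l) : ℕ) : ℤ) := by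
    rw [Nat.cast_mul]; exact (dvd_lcmUpto_max_left (l := l) hk).mul_left _
  have hk0 : ((k : ℤ) : ℝ) ≠ 0 := by exact_mod_cast (by omega : k ≠ 0)
  rw [lemma26R, map_neg, map_mul, map_mul, aeval_C, algebraMap_int_eq, eq_intCast, Int.cast_div hdvd hk0,
    map_pow, aeval_X, aeval_cHat hl _ hz, show k + l - 1 - (k - 1) = l by omega]
  push_cast
  ring

/-- `P(z)` evaluated: `= d²(z−1)^{k+l}/(kl) − Σ_{i≠k−1} (d²/(k(i−k+1))) (z−1)^{k+l−1−i} c_i (z^{i+1} − z^k)`.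
[cite: RhinViola2005, (2.21)] -/
theorem aeval_lemma26P {k l : ℕ} (hk : 1 ≤ k) (hl : 1 ≤ l) {z : ℝ} (hz : z ≠ 1) :
    aeval z (lemma26P k l) = (Nat.lcmUpto (max k l) : ℝ) * Nat.lcmUpto (max k l) / (k * l) * (z - 1) ^ (k + l) -
      ∑ i ∈ (range (k + l)).erase (k - 1),
        (Nat.lcmUpto (max k l) : ℝ) * Nat.lcmUpto (max k l) / (k * ((i : ℝ) - k + 1)) *
          ((z - 1) ^ (k + l - 1 - i) * (hasseDeriv i ((X : ℝ[X]) ^ k * (1 - X) ^ (l - 1))).eval (1 / (1 - z)) *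
            (z ^ (i + 1) - z ^ k)) := by
  have hdvd0 : ((k * l : ℕ) : ℤ) ∣ ((Nat.lcmUpto (max k l) * Nat.lcmUpto (max k l) : ℕ) : ℤ) := by
    rw [Nat.cast_mul, Nat.cast_mul]
    exact mul_dvd_mul (dvd_lcmUpto_max_left (l := l) hk)
      (DilogPade.natCast_dvd_lcmUpto hl (le_max_right _ _))
  have hkl0 : (((k * l : ℕ) : ℤ) : ℝ) ≠ 0 := by
    have : k * l ≠ 0 := Nat.mul_ne_zero (by omega) (by omega)
    exact_mod_cast this
  rw [lemma26P, map_sub, map_mul, aeval_C, algebraMap_int_eq, eq_intCast, Int.cast_div hdvd0 hkl0, map_pow,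
    map_sub, aeval_X, map_one, map_sum]
  push_cast
  congr 1
  refine sum_congr rfl fun i hi => ?_
  have hi1 : i ≠ k - 1 := (mem_erase.1 hi).1
  have hi2 : i < k + l := mem_range.1 (mem_erase.1 hi).2
  have hdvd : ((k : ℤ) * ((i : ℤ) - k + 1)) ∣ ((Nat.lcmUpto (max k l) : ℤ) * Nat.lcmUpto (max k l)) :=
    mul_dvd_mul (dvd_lcmUpto_max_left (l := l) hk) (sub_dvd_lcmUpto_max hk hi2 hi1)
  have hne : (((k : ℤ) * ((i : ℤ) - k + 1) : ℤ) : ℝ) ≠ 0 := by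
    push_cast
    refine mul_ne_zero (by exact_mod_cast (by omega : k ≠ 0)) ?_
    have : ((i : ℤ) - k + 1) ≠ 0 := by omega
    exact_mod_cast this
  rw [map_mul, aeval_C, algebraMap_int_eq, eq_intCast, Int.cast_div hdvd hne, map_mul, aeval_cHat hl _ hz,
    map_sub, map_pow, map_pow, aeval_X]
  push_cast
  ring

/-! ### Lemma 2.6 -/

/-- **Rhin–Viola 2005, Lemma 2.6, `I^{(1)}`** (`z > 1`, `k, l ≥ 1`):
`d_{max{k,l}}² z^{k+l}(z−1)^{k+l} I_z^{(1)}(0,0,k,l,0) = R(z)`. [cite: RhinViola2005, Lemma 2.6, (2.22)] -/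
theorem lemma26_I1 {z : ℝ} (hz : 1 < z) {k l : ℕ} (hk : 1 ≤ k) (hl : 1 ≤ l) :
    (Nat.lcmUpto (max k l) : ℝ) * Nat.lcmUpto (max k l) * z ^ (k + l) * (z - 1) ^ (k + l) * I1 z 0 0 k l 0 =
      aeval z (lemma26R k l) := by
  have hz0 : z ≠ 0 := by positivity
  have hz1 : z - 1 ≠ 0 := by linarith
  have hk0 : (k : ℝ) ≠ 0 := by exact_mod_cast (by omega : k ≠ 0)
  rw [I1_zero_zero_k_l_zero hz hk hl, aeval_lemma26R hk hl (by linarith), zpow_neg, zpow_natCast, pow_add,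
    pow_add]
  field_simp

/-- **Rhin–Viola 2005, Lemma 2.6, `I_z`** (`z > 1`, `k, l ≥ 1`):
`d_{max{k,l}}² z^{k+l}(z−1)^{k+l} I_z(0,0,k,l,0) = P(z)`. [cite: RhinViola2005, Lemma 2.6, (2.21)] -/
theorem lemma26_I {z : ℝ} (hz : 1 < z) {k l : ℕ} (hk : 1 ≤ k) (hl : 1 ≤ l) :
    (Nat.lcmUpto (max k l) : ℝ) * Nat.lcmUpto (max k l) * z ^ (k + l) * (z - 1) ^ (k + l) * I z 0 0 k l 0 =
      aeval z (lemma26P k l) := by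
  have hz0 : z ≠ 0 := by positivity
  have hz1 : z - 1 ≠ 0 := by linarith
  have hk0 : (k : ℝ) ≠ 0 := by exact_mod_cast (by omega : k ≠ 0)
  have hl0 : (l : ℝ) ≠ 0 := by exact_mod_cast (by omega : l ≠ 0)
  rw [I_zero_zero_k_l_zero hz hk hl, aeval_lemma26P hk hl (by linarith), zpow_neg, zpow_natCast]
  set S := ∑ i ∈ (range (k + l)).erase (k - 1),
    (hasseDeriv i ((X : ℝ[X]) ^ k * (1 - X) ^ (l - 1))).eval (1 / (1 - z)) *
      ((z ^ ((i : ℤ) - k + 1) - 1) * (z - 1) ^ (-((i : ℤ) + 1)) / ((i : ℝ) - k + 1)) with hS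
  -- each term of `P(z)` is `K · (term of S)`, `K = d² z^{k+l}(z−1)^{k+l} z^{−l}/k`
  have hterm : ∀ i ∈ (range (k + l)).erase (k - 1),
      (Nat.lcmUpto (max k l) : ℝ) * Nat.lcmUpto (max k l) / (k * ((i : ℝ) - k + 1)) *
          ((z - 1) ^ (k + l - 1 - i) * (hasseDeriv i ((X : ℝ[X]) ^ k * (1 - X) ^ (l - 1))).eval (1 / (1 - z)) *
            (z ^ (i + 1) - z ^ k)) =
        (Nat.lcmUpto (max k l) : ℝ) * Nat.lcmUpto (max k l) * z ^ (k + l) * (z - 1) ^ (k + l) * (z ^ l)⁻¹ / k *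
          ((hasseDeriv i ((X : ℝ[X]) ^ k * (1 - X) ^ (l - 1))).eval (1 / (1 - z)) *
            ((z ^ ((i : ℤ) - k + 1) - 1) * (z - 1) ^ (-((i : ℤ) + 1)) / ((i : ℝ) - k + 1))) := by
    intro i hi
    have hi1 : i ≠ k - 1 := (mem_erase.1 hi).1
    have hi2 : i < k + l := mem_range.1 (mem_erase.1 hi).2
    have hne : ((i : ℝ) - k + 1) ≠ 0 := by
      have : ((i : ℤ) - k + 1) ≠ 0 := by omega
      exact_mod_cast this
    -- `z^{k+l} z^{−l} z^{i−k+1} = z^{i+1}`, `z^{k+l} z^{−l} = z^k`, `(z−1)^{k+l}(z−1)^{−(i+1)} = (z−1)^{k+l−1−i}`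
    have ez : z ^ (k + l) * (z ^ l)⁻¹ * z ^ ((i : ℤ) - k + 1) = z ^ (i + 1) := by
      rw [← zpow_natCast, ← zpow_natCast, ← zpow_neg, ← zpow_add₀ hz0, ← zpow_add₀ hz0, ← zpow_natCast]
      congr 1
      push_cast
      ring
    have ez' : z ^ (k + l) * (z ^ l)⁻¹ = z ^ k := by rw [pow_add]; field_simp
    have ez1 : (z - 1) ^ (k + l) * (z - 1) ^ (-((i : ℤ) + 1)) = (z - 1) ^ (k + l - 1 - i) := by
      rw [← zpow_natCast, ← zpow_add₀ hz1, ← zpow_natCast]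
      congr 1
      omega
    symm
    calc (Nat.lcmUpto (max k l) : ℝ) * Nat.lcmUpto (max k l) * z ^ (k + l) * (z - 1) ^ (k + l) * (z ^ l)⁻¹ / k *
          ((hasseDeriv i ((X : ℝ[X]) ^ k * (1 - X) ^ (l - 1))).eval (1 / (1 - z)) *
            ((z ^ ((i : ℤ) - k + 1) - 1) * (z - 1) ^ (-((i : ℤ) + 1)) / ((i : ℝ) - k + 1)))
        = (Nat.lcmUpto (max k l) : ℝ) * Nat.lcmUpto (max k l) / (k * ((i : ℝ) - k + 1)) *
            (((z - 1) ^ (k + l) * (z - 1) ^ (-((i : ℤ) + 1))) *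
              (hasseDeriv i ((X : ℝ[X]) ^ k * (1 - X) ^ (l - 1))).eval (1 / (1 - z)) *
              (z ^ (k + l) * (z ^ l)⁻¹ * z ^ ((i : ℤ) - k + 1) - z ^ (k + l) * (z ^ l)⁻¹)) := by
          field_simp
      _ = _ := by rw [ez, ez', ez1]
  rw [sum_congr rfl hterm, ← mul_sum, ← hS]
  field_simp
  ring

/-- **Rhin–Viola 2005, Lemma 2.6** (Theorem 2.1 for `(0,0,k,l,0)`, `k, l ≥ 1`; `H = K = max{k,l}`,
`α = β = δ = k+l`, `Q = 0`): there are `P, R ∈ ℤ[X]` of degree `≤ k + l` with, for every real `z > 1`,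
`d² z^{k+l}(z−1)^{k+l} I_z(0,0,k,l,0) = P(z)`, `d² z^{k+l}(z−1)^{k+l} I_z^{(1)}(0,0,k,l,0) = R(z)` and
`I_z^{(2)}(0,0,k,l,0) = 0`, `d = d_{max{k,l}}`. [cite: RhinViola2005, Lemma 2.6] -/
theorem lemma26 {k l : ℕ} (hk : 1 ≤ k) (hl : 1 ≤ l) :
    ∃ P R : ℤ[X], P.natDegree ≤ k + l ∧ R.natDegree ≤ k + l ∧
      ∀ z : ℝ, 1 < z →
        (Nat.lcmUpto (max k l) : ℝ) * Nat.lcmUpto (max k l) * z ^ (k + l) * (z - 1) ^ (k + l) * I z 0 0 k l 0 =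
            aeval z P ∧
        (Nat.lcmUpto (max k l) : ℝ) * Nat.lcmUpto (max k l) * z ^ (k + l) * (z - 1) ^ (k + l) * I1 z 0 0 k l 0 =
            aeval z R ∧
        I2 z 0 0 k l 0 = 0 :=
  ⟨lemma26P k l, lemma26R k l, natDegree_lemma26P_le k l, natDegree_lemma26R_le hl,
    fun z hz => ⟨lemma26_I hz hk hl, lemma26_I1 hz hk hl, I2_zero_zero_k_l_zero z hk l⟩⟩

end RhinViola

end Literature.NumberTheory.DiophantineApproximation

end
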